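/-
Copyright: the b2b-balaban T⁴-continuum CRUX team, row NE7b OWNER lineage `t4-ne7b-p1` (gen 140). Project licence.
-/
import Summits.QuantumFields.BalabanUV.T4Continuum.Spine.NE7b.SupWhitenedMomentLetters
import Summits.QuantumFields.BalabanUV.T4Continuum.Spine.NE7b.SupBlockFourthMoment

/-!
# POINCARÉ IN WHITENED COORDINATES — the variance of a gradient component under `N(0,AAᵀ)` (SCOPING (d11)(4), the moment letter of the
# third-cumulant bound): (422)'s Brascamp–Lieb∕Poincaré inequality needs a PRECISION `M ≻ 0` with floor `m`; for a singular fluctuation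
# covariance `Γ = AAᵀ` it is read in the `ξ`-coordinates, where `M = I` (`m = 1`) and the whitened potential `Ũ(ξ) = U(Aξ+ψ)` inherits the
# secant letter `λ·γ_op` from `U`'s secant letter `λ` and the operator letter `|Aξ|² ≤ γ_op|ξ|²`.  The observables are the gradient components
#   `g_v(ξ) = U′(Aξ + ψ)(e_v)`,   `D_ξg_v = U″(Aξ+ψ)[A·, e_v]`,   `‖D_ξg_v‖ ≤ κ₂√γ_op`,
# so that, UNIFORMLY in `ψ`, `v` and the volume,  `Var(g_v) ≤ κ₂²γ_op∕(1 − λγ_op)`  — and (successor file) the fourth centred moment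
# `≤ 5κ₂⁴γ_op²∕(1 − λγ_op)²`, the letter `m₄` of (461)∕(463) (row NE7b, node U5c; (422), (423), (456)–(458) BY NAME; [folklore] + [cite:
# BrascampLieb1976, Thm 4.1] through (422))

Cell `pub-balaban`, sub-cell `t4`, spine estimate NE7b (`T4WeightBudget.RelWeightBound`; the cell's OWN estimate — NOT PRINTED in
[Bałaban 1983–89], NOT PROVED).  Crux-route work under `Spine/NE7b/` by the row OWNER (`t4-ne7b-p1` gen 140, file (464)) under FREEZE
(0)'s crux-prover clause; NOTHING of Bałaban's is named as a Lean object, valued or asserted; no `T4Continuum/Support` leaf typed; no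
`def`, no notation; zero `sorry`.  Imports (BY NAME): the OWNER's (458) `…SupWhitenedMomentLetters` (`whitened_op_letter`, `whitened_sq_sum_le`,
`op_letter_nonneg`, `posSemidef_AAT`, `whitened_exp_integrable`; through it (457) `whitened_integrable_iff`, (456) `whitened_hasFDerivAt`,
`matrixCLM_single_apply`), (423) `…SupBlockFourthMoment` (`hasFDerivAt_blockObservable`, `integrable_block_moments`; through it (422)
`tilted_poincare`).

WHAT IS PROVED ([folklore]; `A : Matrix ι κ ℝ`, `T = matrixCLM A`, the block class letters, `(γ_op·1 − AAᵀ) ⪰ 0`):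
* §1 `norm_sq_matrixCLM_le` (`‖Tξ‖² ≤ γ_op‖ξ‖²`), `opNorm_matrixCLM_le` (`‖T‖ ≤ √γ_op`), **`whitened_secant`** (`Ũ` has secant letter `λγ_op`),
  `one_floor` (`I` has floor `1`).
* §2 **`whitened_obs_hasFDerivAt`** (`D_ξg_v = ((U″(Tξ+ψ)).flip e_v) ∘ T`, continuous, `‖·‖ ≤ κ₂√γ_op`).
* §3 the integrability letters in `ξ`-coordinates by pushforward of (423): **`whitened_obs_moments`** (`e^{−Ũ}|g_v|^k ∈ L¹(N(0,I))`, `k = 1,2,4`,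
  and `k = 3`).
* §4 THE END **`whitened_variance_le`** (`Var_ν̃(g_v) ≤ κ₂²γ_op∕(1 − λγ_op)` in the `N(0,I)` format).

HONEST (what this is NOT).  The fourth centred moment (Poincaré on `(g_v − μ)²`) and its transfer to the road's `N(0,AAᵀ)` format and to
(461)'s Gibbs format are the successor file; the secant letter `λ ≥ 0` of `U` on all sites is the class hypothesis of (422) (Prékopa–Leindler
needs it globally).  Scalar skeleton ((A3), NC-NE7b-α UNRULED); nothing of Bałaban's asserted.  BY-NAME EFFECT ON THE WALL: NONE.  NE7b NOT
PRINTED ∕ NOT PROVED; spine PROVED 0∕9; rung (B)+1 — the programme's measures remain FINITE-torus statements; NOT the mass gap, NOT Clay.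
HONEST DEPENDENCY: continuum YM on T⁴ ⇐ BetaPertH ∧ nine spine estimates (0∕9 proved); BetaPertH ⇐ (D1) ∧ (D4) ∧ CAP+tail; G-an2-4 gates
asym, D1 and NE2∕3∕4.
-/

set_option autoImplicit false
set_option maxSynthPendingDepth 2

noncomputable section

namespace Summit.QuantumFields.BalabanUV.T4Continuum.NE7b.SupWhitenedPoincareLetters

open MeasureTheory ProbabilityTheory Real Set Function Finset Matrix
open scoped BigOperators
open Literature.Probability.Distributions (matrixCLM ofLp_matrixCLM)
open SupWhitenedMomentLetters (whitened_op_letter whitened_sq_sum_le op_letter_nonneg posSemidef_AAT whitened_exp_integrable)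
open SupWhitenedCovarianceKernelLetter (whitened_integrable_iff)
open SupWhitenedFirstOrderLetters (whitened_hasFDerivAt matrixCLM_single_apply)
open SupBlockFourthMoment (hasFDerivAt_blockObservable integrable_block_moments)
open SupTiltedPoincare (tilted_poincare)
open SupBlockEffectiveActionDerivative (integrable_exp_neg_block)

variable {ι κ : Type} [Fintype ι] [DecidableEq ι] [Fintype κ] [DecidableEq κ]

variable {U : EuclideanSpace ℝ ι → ℝ} {U' : EuclideanSpace ℝ ι → EuclideanSpace ℝ ι →L[ℝ] ℝ}
  {U'' : EuclideanSpace ℝ ι → EuclideanSpace ℝ ι →L[ℝ] EuclideanSpace ℝ ι →L[ℝ] ℝ} {A : Matrix ι κ ℝ}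
  {ψ : EuclideanSpace ℝ ι} {γop κ₀ κ₁ κ₂ a τ δ θ lam : ℝ}

/-! ## §1. The factor's operator norm and the whitened secant letter -/

/-- **`‖Tξ‖² ≤ γ_op‖ξ‖²`** from `(γ_op·1 − AAᵀ) ⪰ 0`. [folklore] -/
theorem norm_sq_matrixCLM_le [Nonempty ι] (hΓop : (γop • (1 : Matrix ι ι ℝ) - A * Aᵀ).PosSemidef) (ξ : EuclideanSpace ℝ κ) :
    ‖matrixCLM A ξ‖ ^ 2 ≤ γop * ‖ξ‖ ^ 2 := by
  rw [EuclideanSpace.real_norm_sq_eq, EuclideanSpace.real_norm_sq_eq]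
  have h := whitened_sq_sum_le hΓop Finset.univ ξ
  exact h

/-- **`‖T‖ ≤ √γ_op`**. [folklore] -/
theorem opNorm_matrixCLM_le [Nonempty ι] (hΓop : (γop • (1 : Matrix ι ι ℝ) - A * Aᵀ).PosSemidef) : ‖matrixCLM A‖ ≤ Real.sqrt γop := by
  refine ContinuousLinearMap.opNorm_le_bound _ (Real.sqrt_nonneg _) fun ξ => ?_
  have h := norm_sq_matrixCLM_le hΓop ξ
  have hγ := op_letter_nonneg hΓop
  have e : γop * ‖ξ‖ ^ 2 = (Real.sqrt γop * ‖ξ‖) ^ 2 := by rw [mul_pow, Real.sq_sqrt hγ]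
  rw [e] at h
  have h2 := Real.sqrt_le_sqrt h
  rwa [Real.sqrt_sq (norm_nonneg _), Real.sqrt_sq (by positivity)] at h2

/-- **THE WHITENED SECANT LETTER**: `U`'s secant letter `λ ≥ 0` (`U((1−s)a+sb) − (λ∕2)s(1−s)Σ(a−b)² ≤ (1−s)U(a) + sU(b)`) gives `Ũ = U(T·+ψ)`
the secant letter `λγ_op`. [folklore] -/
theorem whitened_secant [Nonempty ι] (hΓop : (γop • (1 : Matrix ι ι ℝ) - A * Aᵀ).PosSemidef) (hlam : 0 ≤ lam)
    (hUsec : ∀ s : ℝ, 0 ≤ s → s ≤ 1 → ∀ a b : EuclideanSpace ℝ ι,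
      U ((1 - s) • a + s • b) - lam / 2 * (s * (1 - s)) * ∑ i, (a i - b i) ^ 2 ≤ (1 - s) * U a + s * U b)
    (ψ : EuclideanSpace ℝ ι) (s : ℝ) (hs0 : 0 ≤ s) (hs1 : s ≤ 1) (a b : EuclideanSpace ℝ κ) :
    U (matrixCLM A ((1 - s) • a + s • b) + ψ) - lam * γop / 2 * (s * (1 - s)) * ∑ i, (a i - b i) ^ 2 ≤
      (1 - s) * U (matrixCLM A a + ψ) + s * U (matrixCLM A b + ψ) := by
  have e : matrixCLM A ((1 - s) • a + s • b) + ψ = (1 - s) • (matrixCLM A a + ψ) + s • (matrixCLM A b + ψ) := by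
    rw [map_add, map_smul, map_smul, smul_add, smul_add]
    have : ψ = (1 - s) • ψ + s • ψ := by rw [← add_smul]; simp
    conv_lhs => rw [this]
    abel
  have h := hUsec s hs0 hs1 (matrixCLM A a + ψ) (matrixCLM A b + ψ)
  rw [← e] at h
  -- `Σ_i ((Ta+ψ)_i − (Tb+ψ)_i)² = Σ_i (T(a−b))_i² ≤ γ_op Σ_w (a_w − b_w)²`
  have hd : ∀ i, (matrixCLM A a + ψ) i - (matrixCLM A b + ψ) i = matrixCLM A (a - b) i := fun i => by
    rw [map_sub]; simp only [PiLp.add_apply, PiLp.sub_apply]; ring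
  have hsq : ∑ i, ((matrixCLM A a + ψ) i - (matrixCLM A b + ψ) i) ^ 2 ≤ γop * ∑ w, (a w - b w) ^ 2 := by
    simp_rw [hd]
    have h1 := whitened_sq_sum_le hΓop Finset.univ (a - b)
    simpa only [PiLp.sub_apply] using h1
  have hss : 0 ≤ lam / 2 * (s * (1 - s)) := by
    have : 0 ≤ s * (1 - s) := mul_nonneg hs0 (by linarith)
    positivity
  have h2 := mul_le_mul_of_nonneg_left hsq hss
  have e2 : lam / 2 * (s * (1 - s)) * (γop * ∑ w, (a w - b w) ^ 2) = lam * γop / 2 * (s * (1 - s)) * ∑ w, (a w - b w) ^ 2 := by ring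
  linarith

omit [Fintype ι] [DecidableEq ι] in
/-- The identity precision has floor `1`: `1·Σz² ≤ z·(I z)`. [folklore] -/
theorem one_floor (z : κ → ℝ) : 1 * ∑ i, z i ^ 2 ≤ z ⬝ᵥ ((1 : Matrix κ κ ℝ) *ᵥ z) := by
  rw [one_mulVec, one_mul]
  simp only [dotProduct, sq]
  exact le_rfl

/-! ## §2. The observable `g_v(ξ) = U′(Tξ + ψ)(e_v)` -/

/-- **`D_ξ g_v = ((U″(Tξ+ψ)).flip e_v) ∘ T`**, continuous in `ξ`, of norm `≤ κ₂√γ_op`. [folklore] -/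
theorem whitened_obs_hasFDerivAt [Nonempty ι] (hΓop : (γop • (1 : Matrix ι ι ℝ) - A * Aᵀ).PosSemidef)
    (hU'd : ∀ φ : EuclideanSpace ℝ ι, HasFDerivAt U' (U'' φ) φ) (hU''c : Continuous U'') (hU''b : ∀ φ : EuclideanSpace ℝ ι, ‖U'' φ‖ ≤ κ₂)
    (ψ : EuclideanSpace ℝ ι) (v : ι) :
    (∀ ξ : EuclideanSpace ℝ κ, HasFDerivAt (fun ξ : EuclideanSpace ℝ κ => U' (matrixCLM A ξ + ψ) (EuclideanSpace.single v (1 : ℝ)))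
        (((U'' (matrixCLM A ξ + ψ)).flip (EuclideanSpace.single v (1 : ℝ))).comp (matrixCLM A)) ξ) ∧
      Continuous (fun ξ : EuclideanSpace ℝ κ => ((U'' (matrixCLM A ξ + ψ)).flip (EuclideanSpace.single v (1 : ℝ))).comp (matrixCLM A)) ∧
      ∀ ξ : EuclideanSpace ℝ κ, ‖((U'' (matrixCLM A ξ + ψ)).flip (EuclideanSpace.single v (1 : ℝ))).comp (matrixCLM A)‖ ≤ κ₂ * Real.sqrt γop := by
  obtain ⟨hAd, hA'c, hA'b⟩ := hasFDerivAt_blockObservable hU'd hU''c hU''b ψ (EuclideanSpace.single v (1 : ℝ))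
  have hv : ‖(EuclideanSpace.single v (1 : ℝ) : EuclideanSpace ℝ ι)‖ = 1 := by simp
  refine ⟨fun ξ => ?_, ?_, fun ξ => ?_⟩
  · exact (hAd (matrixCLM A ξ)).comp ξ (matrixCLM A).hasFDerivAt
  · exact ((ContinuousLinearMap.compL ℝ (EuclideanSpace ℝ κ) (EuclideanSpace ℝ ι) ℝ).flip (matrixCLM A)).continuous.comp
      (hA'c.comp (matrixCLM A).continuous)
  · have hb' := hA'b (matrixCLM A ξ)
    rw [hv, mul_one] at hb'
    calc ‖((U'' (matrixCLM A ξ + ψ)).flip (EuclideanSpace.single v (1 : ℝ))).comp (matrixCLM A)‖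
        ≤ ‖(U'' (matrixCLM A ξ + ψ)).flip (EuclideanSpace.single v (1 : ℝ))‖ * ‖matrixCLM A‖ := ContinuousLinearMap.opNorm_comp_le _ _
      _ ≤ κ₂ * Real.sqrt γop := mul_le_mul hb' (opNorm_matrixCLM_le hΓop) (norm_nonneg _) (le_trans (norm_nonneg _) hb')

/-! ## §3. The integrability letters in `ξ`-coordinates -/

/-- **`e^{−U(Tξ+ψ)}·|g_v(ξ)|^k ∈ L¹(N(0,I_κ))` for `k = 1, 2, 3, 4`** (pushforward of (423)'s moments, `|U′(φ)e_v| ≤ ‖U′(φ)‖`). [folklore] -/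
theorem whitened_obs_moments (hΓop : (γop • (1 : Matrix ι ι ℝ) - A * Aᵀ).PosSemidef) (Y : Finset ι)
    (hUd : ∀ φ : EuclideanSpace ℝ ι, HasFDerivAt U (U' φ) φ) (hU'd : ∀ φ : EuclideanSpace ℝ ι, HasFDerivAt U' (U'' φ) φ)
    (hκ₀ : 0 ≤ κ₀) (hκ₁ : 0 ≤ κ₁) (ha : 0 ≤ a) (hτ : 0 < τ) (hδ : 0 < δ) (hθ1 : θ < 1) (hκθ : (2 * κ₀ * (1 + τ) + 4 * δ) * γop ≤ θ)
    (hstab : ∀ φ : EuclideanSpace ℝ ι, -(κ₀ * ∑ x ∈ Y, φ x ^ 2) ≤ U φ) (hU'b : ∀ φ : EuclideanSpace ℝ ι, ‖U' φ‖ ≤ κ₁ * (a + ∑ x ∈ Y, φ x ^ 2))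
    (ψ : EuclideanSpace ℝ ι) (v : ι) :
    Integrable (fun ξ : EuclideanSpace ℝ κ => exp (-U (matrixCLM A ξ + ψ)) * U' (matrixCLM A ξ + ψ) (EuclideanSpace.single v (1 : ℝ)))
        (multivariateGaussian 0 (1 : Matrix κ κ ℝ)) ∧
      Integrable (fun ξ : EuclideanSpace ℝ κ => exp (-U (matrixCLM A ξ + ψ)) * U' (matrixCLM A ξ + ψ) (EuclideanSpace.single v (1 : ℝ)) ^ 2)
        (multivariateGaussian 0 (1 : Matrix κ κ ℝ)) ∧
      Integrable (fun ξ : EuclideanSpace ℝ κ => exp (-U (matrixCLM A ξ + ψ)) * |U' (matrixCLM A ξ + ψ) (EuclideanSpace.single v (1 : ℝ))| ^ 3)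
        (multivariateGaussian 0 (1 : Matrix κ κ ℝ)) ∧
      Integrable (fun ξ : EuclideanSpace ℝ κ => exp (-U (matrixCLM A ξ + ψ)) * U' (matrixCLM A ξ + ψ) (EuclideanSpace.single v (1 : ℝ)) ^ 4)
        (multivariateGaussian 0 (1 : Matrix κ κ ℝ)) := by
  have hU'c : Continuous U' := continuous_iff_continuousAt.2 fun φ => (hU'd φ).continuousAt
  have hUc : Continuous U := continuous_iff_continuousAt.2 fun φ => (hUd φ).continuousAt
  obtain ⟨i1, i2, i4⟩ := integrable_block_moments (posSemidef_AAT A) hΓop Y hUd hU'c hκ₀ hκ₁ ha hτ hδ hθ1 hκθ hstab hU'b ψ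
  -- continuity of the pieces on `ℝ^ι`
  have hsh : Continuous fun ω : EuclideanSpace ℝ ι => ω + ψ := continuous_id.add continuous_const
  have hEc : Continuous fun ω : EuclideanSpace ℝ ι => exp (-U (ω + ψ)) := continuous_exp.comp (hUc.comp hsh).neg
  have hgc : Continuous fun ω : EuclideanSpace ℝ ι => U' (ω + ψ) (EuclideanSpace.single v (1 : ℝ)) := (hU'c.comp hsh).clm_apply continuous_const
  have hb : ∀ ω : EuclideanSpace ℝ ι, |U' (ω + ψ) (EuclideanSpace.single v (1 : ℝ))| ≤ ‖U' (ω + ψ)‖ := fun ω => by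
    have h := ContinuousLinearMap.le_opNorm (U' (ω + ψ)) (EuclideanSpace.single v (1 : ℝ))
    rw [Real.norm_eq_abs] at h
    simpa using h
  -- domination on `ℝ^ι`, then pushforward
  have key : ∀ k : ℕ, Integrable (fun ω : EuclideanSpace ℝ ι => exp (-U (ω + ψ)) * ‖U' (ω + ψ)‖ ^ k) (multivariateGaussian 0 (A * Aᵀ)) →
      Integrable (fun ξ : EuclideanSpace ℝ κ => exp (-U (matrixCLM A ξ + ψ)) * |U' (matrixCLM A ξ + ψ) (EuclideanSpace.single v (1 : ℝ))| ^ k)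
        (multivariateGaussian 0 (1 : Matrix κ κ ℝ)) := fun k hk => by
    have hω : Integrable (fun ω : EuclideanSpace ℝ ι => exp (-U (ω + ψ)) * |U' (ω + ψ) (EuclideanSpace.single v (1 : ℝ))| ^ k) (multivariateGaussian 0 (A * Aᵀ)) :=
      hk.mono' ((hEc.mul ((continuous_abs.comp hgc).pow k)).aestronglyMeasurable) (ae_of_all _ fun ω => by
        rw [Real.norm_eq_abs, abs_of_nonneg (mul_nonneg (exp_pos _).le (pow_nonneg (abs_nonneg _) k))]
        exact mul_le_mul_of_nonneg_left (pow_le_pow_left₀ (abs_nonneg _) (hb ω) k) (exp_pos _).le)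
    exact (whitened_integrable_iff A (hEc.mul ((continuous_abs.comp hgc).pow k)).aestronglyMeasurable).1 hω
  have k1 := key 1 (by simpa only [pow_one] using i1)
  have k2 := key 2 i2
  have k4 := key 4 i4
  have k3 : Integrable (fun ξ : EuclideanSpace ℝ κ => exp (-U (matrixCLM A ξ + ψ)) * |U' (matrixCLM A ξ + ψ) (EuclideanSpace.single v (1 : ℝ))| ^ 3)
      (multivariateGaussian 0 (1 : Matrix κ κ ℝ)) := by
    have hm : Continuous fun ξ : EuclideanSpace ℝ κ => exp (-U (matrixCLM A ξ + ψ)) * |U' (matrixCLM A ξ + ψ) (EuclideanSpace.single v (1 : ℝ))| ^ 3 :=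
      (hEc.comp (matrixCLM A).continuous).mul ((continuous_abs.comp (hgc.comp (matrixCLM A).continuous)).pow 3)
    refine (k2.add k4).mono' hm.aestronglyMeasurable (ae_of_all _ fun ξ => ?_)
    rw [Real.norm_eq_abs, abs_of_nonneg (mul_nonneg (exp_pos _).le (pow_nonneg (abs_nonneg _) 3)), Pi.add_apply]
    set t := |U' (matrixCLM A ξ + ψ) (EuclideanSpace.single v (1 : ℝ))|
    have ht : 0 ≤ t := abs_nonneg _
    have e0 := exp_pos (-U (matrixCLM A ξ + ψ))
    have h3 : t ^ 3 ≤ t ^ 2 + t ^ 4 := by nlinarith [sq_nonneg (t ^ 2 - t), sq_nonneg (t - 1), ht, pow_nonneg ht 2]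
    calc exp (-U (matrixCLM A ξ + ψ)) * t ^ 3 ≤ exp (-U (matrixCLM A ξ + ψ)) * (t ^ 2 + t ^ 4) := mul_le_mul_of_nonneg_left h3 e0.le
      _ = exp (-U (matrixCLM A ξ + ψ)) * t ^ 2 + exp (-U (matrixCLM A ξ + ψ)) * t ^ 4 := by ring
  refine ⟨?_, ?_, k3, ?_⟩
  · refine k1.congr' ?_ ?_
    · exact ((hEc.comp (matrixCLM A).continuous).mul (hgc.comp (matrixCLM A).continuous)).aestronglyMeasurable
    · exact ae_of_all _ fun ξ => by
        rw [pow_one, Real.norm_eq_abs, Real.norm_eq_abs, abs_mul, abs_mul, abs_abs]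
  · exact k2.congr (ae_of_all _ fun ξ => by simp only [sq_abs])
  · exact k4.congr (ae_of_all _ fun ξ => by
      dsimp only
      rw [← abs_pow, abs_of_nonneg (by positivity)])

/-! ## §4. The variance of a gradient component in whitened coordinates -/

/-- **`Var_ν̃(g_v) ≤ κ₂²γ_op∕(1 − λγ_op)`**: (422)'s Poincaré inequality in the `ξ`-coordinates (`M = I`, floor `1`, secant letter `λγ_op`),
for the tilted law `ν̃ ∝ e^{−U(Tξ+ψ)}dN(0,I)(ξ)`; uniform in `ψ`, `v` and the volume. [folklore] -/
theorem whitened_variance_le [Nonempty ι] (hΓop : (γop • (1 : Matrix ι ι ℝ) - A * Aᵀ).PosSemidef) (Y : Finset ι)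
    (hUd : ∀ φ : EuclideanSpace ℝ ι, HasFDerivAt U (U' φ) φ) (hU'd : ∀ φ : EuclideanSpace ℝ ι, HasFDerivAt U' (U'' φ) φ)
    (hU''c : Continuous U'') (hκ₀ : 0 ≤ κ₀) (hκ₁ : 0 ≤ κ₁) (ha : 0 ≤ a) (hτ : 0 < τ) (hδ : 0 < δ) (hθ0 : 0 < θ) (hθ1 : θ < 1)
    (hκθ : (2 * κ₀ * (1 + τ) + 4 * δ) * γop ≤ θ) (hstab : ∀ φ : EuclideanSpace ℝ ι, -(κ₀ * ∑ x ∈ Y, φ x ^ 2) ≤ U φ)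
    (hU'b : ∀ φ : EuclideanSpace ℝ ι, ‖U' φ‖ ≤ κ₁ * (a + ∑ x ∈ Y, φ x ^ 2)) (hU''b : ∀ φ : EuclideanSpace ℝ ι, ‖U'' φ‖ ≤ κ₂) (hlam : 0 ≤ lam)
    (hUsec : ∀ s : ℝ, 0 ≤ s → s ≤ 1 → ∀ a b : EuclideanSpace ℝ ι,
      U ((1 - s) • a + s • b) - lam / 2 * (s * (1 - s)) * ∑ i, (a i - b i) ^ 2 ≤ (1 - s) * U a + s * U b)
    (hρ : lam * γop < 1) (ψ : EuclideanSpace ℝ ι) (v : ι) :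
    (∫ ξ : EuclideanSpace ℝ κ, exp (-U (matrixCLM A ξ + ψ)) ∂(multivariateGaussian 0 (1 : Matrix κ κ ℝ)))⁻¹ *
          (∫ ξ : EuclideanSpace ℝ κ, exp (-U (matrixCLM A ξ + ψ)) * U' (matrixCLM A ξ + ψ) (EuclideanSpace.single v (1 : ℝ)) ^ 2
            ∂(multivariateGaussian 0 (1 : Matrix κ κ ℝ))) -
        ((∫ ξ : EuclideanSpace ℝ κ, exp (-U (matrixCLM A ξ + ψ)) ∂(multivariateGaussian 0 (1 : Matrix κ κ ℝ)))⁻¹ *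
          (∫ ξ : EuclideanSpace ℝ κ, exp (-U (matrixCLM A ξ + ψ)) * U' (matrixCLM A ξ + ψ) (EuclideanSpace.single v (1 : ℝ))
            ∂(multivariateGaussian 0 (1 : Matrix κ κ ℝ)))) ^ 2 ≤
      κ₂ ^ 2 * γop / (1 - lam * γop) := by
  have hUc : Continuous U := continuous_iff_continuousAt.2 fun φ => (hUd φ).continuousAt
  have hγ := op_letter_nonneg hΓop
  have hκθ₀ : 2 * κ₀ * (1 + τ) * γop ≤ θ := SupEffectiveActionDerivative.mul_opBound_le_of_le (by positivity) (by linarith) hθ0.le hκθ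
  have hI := whitened_exp_integrable hΓop Y hUc.measurable hκ₀ hτ hθ1 hκθ₀ hstab ψ
  have hZ : 0 < ∫ ξ : EuclideanSpace ℝ κ, exp (-U (matrixCLM A ξ + ψ)) ∂(multivariateGaussian 0 (1 : Matrix κ κ ℝ)) := integral_exp_pos hI
  have hρ0 : 0 < 1 - lam * γop := sub_pos.2 hρ
  obtain ⟨hgd, hg'c, hg'b⟩ := whitened_obs_hasFDerivAt hΓop hU'd hU''c hU''b ψ v
  obtain ⟨k1, k2, -, -⟩ := whitened_obs_moments hΓop Y hUd hU'd hκ₀ hκ₁ ha hτ hδ hθ1 hκθ hstab hU'b ψ v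
  have hEc : Continuous fun ξ : EuclideanSpace ℝ κ => exp (-U (matrixCLM A ξ + ψ)) :=
    continuous_exp.comp ((hUc.comp ((matrixCLM A).continuous.add continuous_const)).neg)
  have k3 : Integrable (fun ξ : EuclideanSpace ℝ κ => exp (-U (matrixCLM A ξ + ψ)) *
      ‖((U'' (matrixCLM A ξ + ψ)).flip (EuclideanSpace.single v (1 : ℝ))).comp (matrixCLM A)‖ ^ 2) (multivariateGaussian 0 (1 : Matrix κ κ ℝ)) :=
    (hI.mul_const ((κ₂ * Real.sqrt γop) ^ 2)).mono' ((hEc.mul ((continuous_norm.comp hg'c).pow 2)).aestronglyMeasurable)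
      (ae_of_all _ fun ξ => by
        rw [Real.norm_eq_abs, abs_of_nonneg (mul_nonneg (exp_pos _).le (sq_nonneg _))]
        exact mul_le_mul_of_nonneg_left (pow_le_pow_left₀ (norm_nonneg _) (hg'b ξ) 2) (exp_pos _).le)
  -- (422) in the `ξ`-coordinates
  have hP := tilted_poincare (M := (1 : Matrix κ κ ℝ)) (m := 1) (lam := lam * γop) (U := fun η : EuclideanSpace ℝ κ => U (matrixCLM A η + ψ))
    (U' := fun η : EuclideanSpace ℝ κ => (U' (matrixCLM A η + ψ)).comp (matrixCLM A)) Matrix.PosDef.one one_floor (whitened_hasFDerivAt hUd A ψ)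
    (by positivity) (fun s hs0 hs1 a b => whitened_secant hΓop hlam hUsec ψ s hs0 hs1 a b) hρ (0 : EuclideanSpace ℝ κ)
    (by simpa only [add_zero, inv_one] using hI) hgd hg'c (by simpa only [add_zero, inv_one] using k1) (by simpa only [add_zero, inv_one] using k2)
    (by simpa only [add_zero, inv_one] using k3)
  simp only [add_zero, inv_one] at hP
  -- the right side: `Z⁻¹∫e‖g′‖² ≤ κ₂²γ_op`
  have hR : (∫ ξ : EuclideanSpace ℝ κ, exp (-U (matrixCLM A ξ + ψ)) ∂(multivariateGaussian 0 (1 : Matrix κ κ ℝ)))⁻¹ *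
      (∫ ξ : EuclideanSpace ℝ κ, exp (-U (matrixCLM A ξ + ψ)) * ‖((U'' (matrixCLM A ξ + ψ)).flip (EuclideanSpace.single v (1 : ℝ))).comp (matrixCLM A)‖ ^ 2
        ∂(multivariateGaussian 0 (1 : Matrix κ κ ℝ))) ≤ κ₂ ^ 2 * γop := by
    have h1 : (∫ ξ : EuclideanSpace ℝ κ, exp (-U (matrixCLM A ξ + ψ)) * ‖((U'' (matrixCLM A ξ + ψ)).flip (EuclideanSpace.single v (1 : ℝ))).comp
        (matrixCLM A)‖ ^ 2 ∂(multivariateGaussian 0 (1 : Matrix κ κ ℝ))) ≤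
        ∫ ξ : EuclideanSpace ℝ κ, exp (-U (matrixCLM A ξ + ψ)) * (κ₂ * Real.sqrt γop) ^ 2 ∂(multivariateGaussian 0 (1 : Matrix κ κ ℝ)) :=
      integral_mono k3 (hI.mul_const _) fun ξ => mul_le_mul_of_nonneg_left (pow_le_pow_left₀ (norm_nonneg _) (hg'b ξ) 2) (exp_pos _).le
    rw [integral_mul_const] at h1
    have e : (κ₂ * Real.sqrt γop) ^ 2 = κ₂ ^ 2 * γop := by rw [mul_pow, Real.sq_sqrt hγ]
    calc _ ≤ (∫ ξ : EuclideanSpace ℝ κ, exp (-U (matrixCLM A ξ + ψ)) ∂(multivariateGaussian 0 (1 : Matrix κ κ ℝ)))⁻¹ *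
          ((∫ ξ : EuclideanSpace ℝ κ, exp (-U (matrixCLM A ξ + ψ)) ∂(multivariateGaussian 0 (1 : Matrix κ κ ℝ))) * (κ₂ * Real.sqrt γop) ^ 2) :=
          mul_le_mul_of_nonneg_left h1 (inv_nonneg.2 hZ.le)
      _ = κ₂ ^ 2 * γop := by rw [← mul_assoc, inv_mul_cancel₀ hZ.ne', one_mul, e]
  calc _ ≤ (1 - lam * γop)⁻¹ * ((∫ ξ : EuclideanSpace ℝ κ, exp (-U (matrixCLM A ξ + ψ)) ∂(multivariateGaussian 0 (1 : Matrix κ κ ℝ)))⁻¹ *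
        (∫ ξ : EuclideanSpace ℝ κ, exp (-U (matrixCLM A ξ + ψ)) * ‖((U'' (matrixCLM A ξ + ψ)).flip (EuclideanSpace.single v (1 : ℝ))).comp (matrixCLM A)‖ ^ 2
          ∂(multivariateGaussian 0 (1 : Matrix κ κ ℝ)))) := hP
    _ ≤ (1 - lam * γop)⁻¹ * (κ₂ ^ 2 * γop) := mul_le_mul_of_nonneg_left hR (inv_nonneg.2 hρ0.le)
    _ = κ₂ ^ 2 * γop / (1 - lam * γop) := by rw [div_eq_inv_mul]

end Summit.QuantumFields.BalabanUV.T4Continuum.NE7b.SupWhitenedPoincareLetters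

end
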